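import Summits.AnomalousDissipation.AnomalousDissipation.Theorems.ImpulseGridGridInjectionIdentity

/-!
# Route ImpulseGrid (AnomalousDissipation) — crux `GridThesis`, line `Sketch`: work-split transfer

Stub `stub_workSplitTransfer` (W2) of the line skeleton for the crux
`Summit.AnomalousDissipation.AnomalousDissipation.Theses.ImpulseGrid.GridThesis`
(item stmt-AnomalousDissipation-1770).

The LINEAR form C⁺ of the crux — the design clauses of `GridThesis` verbatim, a bounded-energy
no-leak vanishing-viscosity drift family and, in one Banach mean `Λ`, DC work
`DCⱼ := Λ⟨(G,uⱼ)⟩ ≥ 0` and AC work `ACⱼ := Λ⟨((Φ−1)•G,uⱼ)⟩ ≥ η″ > 0` — implies `GridThesis`, given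
the Laplacian pairing bound `|Λ⟨(u,ΔZ)⟩| ≤ ‖ΔZ‖_∞ (1 + ⟨‖u‖²⟩)/2` (first hypothesis).

Proof. By conjunct (1) of the grid injection identity (`impulseGrid_gridInjectionIdentity`, item
stmt-AnomalousDissipation-1774) and the design clause `∫ΦΨ|G|² = 0`,
`Bⱼ := Λ⟨∫⟪wⱼ,(wⱼ·∇)(Ψ•G)⟫⟩ = c·DCⱼ − c·Wⱼ − νⱼRⱼ` with `Wⱼ = Λ⟨(Φ•G,uⱼ)⟩` the injection and
`Rⱼ = Λ⟨(uⱼ,Δ(Ψ•G))⟩`; additivity of `Λ⟨·⟩` on the interval-integrable pairings gives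
`Wⱼ = DCⱼ + ACⱼ`; the pairing bound with `meanEnergy uⱼ ≤ E` gives `|Rⱼ| ≤ K` uniformly in `j`;
hence `Bⱼ = −c·ACⱼ − νⱼRⱼ ≤ −cη″ + νⱼK ≤ −cη″/2` for `j ≥ J` (`νⱼ → 0`). Reindexing the family by
`j ↦ j + J` (`Filter.tendsto_add_atTop_nat`) yields `GridThesis` with `η := cη″/2`; every other
clause is a pointwise-in-`j` copy of a hypothesis.

References: Doering–Foias 2002, §2; Foias–Manley–Rosa–Temam 2001, Ch. IV §3.1 (bookkeeping of
body-forced Navier–Stokes in generalized limits). No new definitions.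
-/

noncomputable section

-- `Summit.<Summit>.<Problem>` is the tree's mandated summit-side namespace (CONVENTIONS §2); for
-- this single-conjunct summit the two coincide, so the duplicate is deliberate.
set_option linter.dupNamespace false

open MeasureTheory Set Filter Topology
open scoped InnerProductSpace RealInnerProductSpace

namespace Summit.AnomalousDissipation.AnomalousDissipation.Theorems

open Summit.AnomalousDissipation.AnomalousDissipation.Theses.ImpulseGrid
open Literature.Analysis.FluidPDE Literature.Analysis.FluidPDE.Torus
open Literature.Analysis.FunctionSpaces Literature.Analysis.FunctionSpaces.Torus

namespace WorkSplitTransfer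

-- adapted from Cruxes/GridThesis/SketchIdeator2.lean (`eventually_signs_of_workSplit`)
/-- **Real-analysis core of the work-split transfer.** If `Bⱼ = c·DCⱼ − c·(DCⱼ + ACⱼ) − νⱼRⱼ`
(the injection identity with `DCⱼ + ACⱼ` the injection), `|Rⱼ| ≤ K`, `ACⱼ ≥ η″ > 0` and
`νⱼ → 0`, then eventually `Bⱼ ≤ −c·η″/2`, i.e. clause (b) of `GridThesis` with `η = c·η″/2`.
[folklore] -/
theorem eventually_signs_of_workSplit {c η'' K : ℝ} (hc : 0 < c) (hη : 0 < η'')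
    {ν DC AC B R : ℕ → ℝ} (hν : Tendsto ν atTop (nhds 0))
    (hid : ∀ j, B j = c * DC j - c * (DC j + AC j) - ν j * R j)
    (hR : ∀ j, |R j| ≤ K) (hAC : ∀ j, η'' ≤ AC j) :
    ∃ J : ℕ, ∀ j, J ≤ j → B j ≤ -(c * η'' / 2) := by
  have hK : 0 ≤ K := le_trans (abs_nonneg _) (hR 0)
  have hε : 0 < c * η'' / (2 * (K + 1)) := by positivity
  obtain ⟨J, hJ⟩ := Metric.tendsto_atTop.mp hν _ hε
  refine ⟨J, fun j hj => ?_⟩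
  have h1 : |ν j| < c * η'' / (2 * (K + 1)) := by
    have := hJ j hj
    simpa [Real.dist_eq] using this
  have h2 : |ν j * R j| ≤ c * η'' / 2 := by
    rw [abs_mul]
    have hK1 : 0 < K + 1 := by linarith
    calc |ν j| * |R j| ≤ (c * η'' / (2 * (K + 1))) * K :=
          mul_le_mul h1.le (hR j) (abs_nonneg _) hε.le
      _ ≤ (c * η'' / (2 * (K + 1))) * (K + 1) :=
          mul_le_mul_of_nonneg_left (by linarith) hε.le
      _ = c * η'' / 2 := by field_simp
  have h3 : -(ν j * R j) ≤ c * η'' / 2 := le_trans (neg_le_abs _) h2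
  have h4 : B j = -(c * AC j) - ν j * R j := by rw [hid j]; ring
  have h5 : c * η'' ≤ c * AC j := mul_le_mul_of_nonneg_left (hAC j) hc.le
  rw [h4]
  linarith

/-- **The injection splits into DC and AC work**, `Λ⟨((Φ−1)•G,u)⟩ = Λ⟨(Φ•G,u)⟩ − Λ⟨(G,u)⟩`, along a
global Leray–Hopf solution: pointwise in `t ≥ 0` the slice `u t` is square integrable and the
fields are continuous, so the spatial integral splits; then additivity of the generalized
long-time average on pairings that are interval integrable on every `[0, T]`
(`GridInjection.longTimeAvg_sub`, `GridInjection.intervalIntegrable_inner`). [folklore] -/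
theorem longTimeAvg_inner_sub_one_smul (Λ : GeneralizedLimit) {ν : ℝ}
    {Φ : UnitAddTorus (Fin 3) → ℝ} {G F u₀ : UnitAddTorus (Fin 3) → EuclideanSpace ℝ (Fin 3)}
    {u : ℝ → UnitAddTorus (Fin 3) → EuclideanSpace ℝ (Fin 3)} (hΦ : Continuous Φ)
    (hG : Continuous G) (hu : IsGlobalLerayHopf ν (fun _ => F) u₀ u) :
    Λ.longTimeAvg (fun t => ∫ x, ⟪(Φ x - 1) • G x, u t x⟫) =
      Λ.longTimeAvg (fun t => ∫ x, ⟪Φ x • G x, u t x⟫) -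
        Λ.longTimeAvg (fun t => ∫ x, ⟪G x, u t x⟫) := by
  -- the slices `u t`, `t ≥ 0`, are square integrable
  have hmem : ∀ t : ℝ, 0 ≤ t → MemLp (u t) 2 volume := fun t ht =>
    (hu (t + 1) (by linarith)).memLp t ⟨ht, by linarith⟩
  -- the pointwise-in-time split
  have h1 : ∀ t : ℝ, 0 < t → (∫ x, ⟪(Φ x - 1) • G x, u t x⟫) =
      (∫ x, ⟪Φ x • G x, u t x⟫) - ∫ x, ⟪G x, u t x⟫ := by
    intro t ht
    have hi : Integrable (u t) volume := (hmem t ht.le).integrable one_le_two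
    have iB : Integrable (fun x => ⟪Φ x • G x, u t x⟫) volume :=
      (integrable_inner_of_continuous hi (hΦ.smul hG)).congr
        (ae_of_all _ fun x => real_inner_comm _ _)
    have iC : Integrable (fun x => ⟪G x, u t x⟫) volume :=
      (integrable_inner_of_continuous hi hG).congr (ae_of_all _ fun x => real_inner_comm _ _)
    rw [← integral_sub iB iC]
    refine integral_congr_ae (ae_of_all _ fun x => ?_)
    show ⟪(Φ x - 1) • G x, u t x⟫ = ⟪Φ x • G x, u t x⟫ - ⟪G x, u t x⟫
    rw [sub_smul, one_smul, inner_sub_left]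
  -- interval integrability of the two pairings
  have hB : ∀ T, 0 < T → IntervalIntegrable (fun t => ∫ x, ⟪Φ x • G x, u t x⟫) volume 0 T := by
    intro T hT
    refine (GridInjection.intervalIntegrable_inner hu (hΦ.smul hG) hT).congr fun t _ => ?_
    exact integral_congr_ae (ae_of_all _ fun x => real_inner_comm _ _)
  have hC : ∀ T, 0 < T → IntervalIntegrable (fun t => ∫ x, ⟪G x, u t x⟫) volume 0 T := by
    intro T hT
    refine (GridInjection.intervalIntegrable_inner hu hG hT).congr fun t _ => ?_
    exact integral_congr_ae (ae_of_all _ fun x => real_inner_comm _ _)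
  rw [Λ.longTimeAvg_congr h1, GridInjection.longTimeAvg_sub Λ hB hC]

end WorkSplitTransfer

/-- **Stub (W2) of line `Sketch` for the crux `GridThesis` (stmt-AnomalousDissipation-1770): the
work-split transfer C⁺ ⇒ crux.** Given the Laplacian pairing bound (first hypothesis), the linear
form C⁺ of the crux (second hypothesis: design clauses of `GridThesis`, a bounded-energy no-leak
vanishing-viscosity drift family, DC work `Λ⟨(G,uⱼ)⟩ ≥ 0` and AC work `Λ⟨((Φ−1)•G,uⱼ)⟩ ≥ η″ > 0`)
implies `GridThesis`: by conjunct (1) of `impulseGrid_gridInjectionIdentity` and `∫ΦΨ|G|² = 0`,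
`Bⱼ := Λ⟨∫⟪wⱼ,(wⱼ·∇)(Ψ•G)⟫⟩ = c·DCⱼ − c·(DCⱼ + ACⱼ) − νⱼRⱼ` with `|Rⱼ| ≤ ‖Δ(Ψ•G)‖_∞(1+E)/2`, so
`ACⱼ ≥ η″` and `νⱼ → 0` give `Bⱼ ≤ −cη″/2` for `j ≥ J`; reindex the family by `j ↦ j + J` and take
`η := cη″/2`. [folklore] -/
theorem stub_workSplitTransfer :
    (∀ (Λ : GeneralizedLimit) (ν M : ℝ)
      (f Z u₀ : UnitAddTorus (Fin 3) → EuclideanSpace ℝ (Fin 3))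
      (u : ℝ → UnitAddTorus (Fin 3) → EuclideanSpace ℝ (Fin 3)),
      IsSmooth Z → (∀ x, ‖laplacian Z x‖ ≤ M) →
      IsGlobalLerayHopf ν (fun _ => f) u₀ u →
      (∃ C : ℝ, ∀ t : ℝ, 0 ≤ t → kineticEnergy (u t) ≤ C) →
      |Λ.longTimeAvg (fun t => ∫ x, ⟪u t x, laplacian Z x⟫)| ≤ M * (1 + meanEnergy u) / 2) →
    (∃ (Φ Ψ : UnitAddTorus (Fin 3) → ℝ) (G : UnitAddTorus (Fin 3) → EuclideanSpace ℝ (Fin 3))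
      (c η'' : ℝ) (Λ : GeneralizedLimit),
      IsSmooth Φ ∧ IsSmooth Ψ ∧ IsSmooth G ∧
      (∀ (s : UnitAddCircle) x,
        Ψ (x + Pi.single (1 : Fin 3) s) = Ψ x ∧ Ψ (x + Pi.single (2 : Fin 3) s) = Ψ x) ∧
      (∀ (s : UnitAddCircle) x, G (x + Pi.single (0 : Fin 3) s) = G x) ∧ (∀ x, G x 0 = 0) ∧
      IsDivFree G ∧ (∀ x, partialDeriv 0 Ψ x = Φ x - 1) ∧ (∫ x, Φ x * Ψ x * ‖G x‖ ^ 2 = 0) ∧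
      IsSmooth (fun x => Φ x • G x) ∧ IsDivFree (fun x => Φ x • G x) ∧
      HasZeroMean (fun x => Φ x • G x) ∧ 0 < c ∧ 0 < η'' ∧
      ∃ (ν : ℕ → ℝ) (u₀ : ℕ → UnitAddTorus (Fin 3) → EuclideanSpace ℝ (Fin 3))
        (u : ℕ → ℝ → UnitAddTorus (Fin 3) → EuclideanSpace ℝ (Fin 3)),
        (∀ j, 0 < ν j) ∧ Tendsto ν atTop (nhds 0) ∧
        (∀ j, IsGlobalLerayHopf (ν j) (fun _ => fun x => Φ x • G x) (u₀ j) (u j)) ∧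
        (∀ j, ∃ C : ℝ, ∀ t : ℝ, 0 ≤ t → kineticEnergy (u j t) ≤ C) ∧
        (∀ j, ∫ x, u₀ j x = c • EuclideanSpace.single 0 1) ∧
        (∃ E : ℝ, ∀ j, meanEnergy (u j) ≤ E) ∧
        (∀ j, longTimeAvgSup (fun t => ∫ x, ⟪Φ x • G x, u j t x⟫) ≤ meanDissipation (ν j) (u j)) ∧
        (∀ j, 0 ≤ Λ.longTimeAvg (fun t => ∫ x, ⟪G x, u j t x⟫)) ∧
        (∀ j, η'' ≤ Λ.longTimeAvg (fun t => ∫ x, ⟪(Φ x - 1) • G x, u j t x⟫))) →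
    GridThesis := by
  intro hPB hC
  obtain ⟨Φ, Ψ, G, c, η'', Λ, hΦ, hΨ, hG, hΨinv, hGinv, hG0, hGdiv, hΨ', hΦΨG, hfs, hfdiv, hfmean,
    hc, hη, ν, u₀, u, hν, hν0, hLH, hsup, hdrift, ⟨E, hE⟩, hNL, hDC, hAC⟩ := hC
  -- a `j`-uniform bound for the viscous pairing `Rⱼ = Λ⟨(uⱼ, Δ(Ψ•G))⟩` (pairing bound)
  have hV : IsSmooth (fun y => Ψ y • G y) := hΨ.smul' hG
  obtain ⟨M, hM0, hM⟩ := exists_nonneg_forall_norm_le_of_continuous hV.laplacian.continuous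
  have hR : ∀ j, |Λ.longTimeAvg (fun t => ∫ x, ⟪u j t x, laplacian (fun y => Ψ y • G y) x⟫)| ≤
      M * (1 + E) / 2 := by
    intro j
    refine (hPB Λ (ν j) M (fun x => Φ x • G x) (fun y => Ψ y • G y) (u₀ j) (u j) hV hM (hLH j)
      (hsup j)).trans ?_
    have h := mul_le_mul_of_nonneg_left (hE j) hM0
    linarith
  -- the injection splits into DC and AC work
  have hW : ∀ j, Λ.longTimeAvg (fun t => ∫ x, ⟪(Φ x - 1) • G x, u j t x⟫) =
      Λ.longTimeAvg (fun t => ∫ x, ⟪Φ x • G x, u j t x⟫) -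
        Λ.longTimeAvg (fun t => ∫ x, ⟪G x, u j t x⟫) := fun j =>
    WorkSplitTransfer.longTimeAvg_inner_sub_one_smul Λ hΦ.continuous hG.continuous (hLH j)
  -- conjunct (1) of the grid injection identity with `∫ΦΨ|G|² = 0`
  have hid : ∀ j, Λ.longTimeAvg (fun t => ∫ x, ⟪u j t x - c • EuclideanSpace.single 0 1,
      convect (fun y => u j t y - c • EuclideanSpace.single 0 1) (fun y => Ψ y • G y) x⟫) =
      c * Λ.longTimeAvg (fun t => ∫ x, ⟪G x, u j t x⟫) -
        c * (Λ.longTimeAvg (fun t => ∫ x, ⟪G x, u j t x⟫) +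
          Λ.longTimeAvg (fun t => ∫ x, ⟪(Φ x - 1) • G x, u j t x⟫)) -
        ν j * Λ.longTimeAvg (fun t => ∫ x, ⟪u j t x, laplacian (fun y => Ψ y • G y) x⟫) := by
    intro j
    have h := (impulseGrid_gridInjectionIdentity Λ (ν j) c Φ Ψ G (u₀ j) (u j) (hν j) hΦ hΨ hG hΨinv
      hGinv hG0 hGdiv hΨ' (hLH j) (hsup j)).1
    rw [hΦΨG, sub_zero] at h
    linear_combination h + c * hW j
  -- the real-analysis core: clause (b) with `η := cη″/2` along a tail
  obtain ⟨J, hJ⟩ := WorkSplitTransfer.eventually_signs_of_workSplit hc hη hν0 hid hR hAC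
  -- `GridThesis` along the reindexed tail `j ↦ j + J`
  refine ⟨Φ, Ψ, G, c, c * η'' / 2, Λ, hΦ, hΨ, hG, hΨinv, hGinv, hG0, hGdiv, hΨ', hΦΨG, hfs, hfdiv,
    hfmean, hc, by positivity, fun j => ν (j + J), fun j => u₀ (j + J), fun j => u (j + J),
    fun j => hν _, hν0.comp (tendsto_add_atTop_nat J), fun j => hLH _, fun j => hsup _,
    fun j => hdrift _, ⟨E, fun j => hE _⟩, fun j => hNL _, fun j => hDC _,
    fun j => hJ (j + J) (Nat.le_add_left J j)⟩

end Summit.AnomalousDissipation.AnomalousDissipation.Theorems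

end
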